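import Mathlib
import HarnessLib
import Summits.Schanuel.Schanuel.Theses.TwistedConjugacy

/-!
# Birth skeleton (BC3) — crux `TwistedConjugacy.TwistImpliesTowerPi` (stmt-Schanuel-17225)

Route `route-Schanuel-TwistedConjugacy` ("exp wildly conjugate to exp∘μ + Schanuel relative to
E(2πi)"), crux THE DEFORMATION THEOREM:

  `TwistImpliesTowerPi := TwistedSymmetry → TowerPiSchanuel`, i.e.
  (∃ algebraic `μ`, `‖μ‖ = 1`, not a root of unity, and a ring endomorphism `σ` of `ℂ` fixing `ℚ̄`
   pointwise with `σ(e^z) = e^{μ σ(z)}`) → for `z₁,…,zₙ` `ℚ`-linearly independent with every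
  `zᵢ ∈ E + ℚ·2πi` (`E` = the exp-closure of `ℚ̄`, inlined as an `sInf` of intermediate fields),
  `trdeg_ℚ ℚ(z, e^z) ≥ n`.

This file is the route-level BIRTH CERTIFICATE skeleton of the crux (LENSES-v3 §2 BC3; registrar seat
`planner-skel-stmt-Schanuel-17225-0`, 2026-08-17, route re-audit bin REPAIRABLE): THREE NAMED STUBS and
a kernel-checked composition concluding the crux BY NAME. `sorry` occurs ONLY in the three `stub_*`
theorems.

## The seam: NUMERICAL → FUNCTIONAL (identity theorem) → TRANSCENDENCE (Ax), with the twist data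
## `(μ, σ)` consumed only by the first two stubs

The informal proof filed with the route (item docstring; the opener's DEFORMATION.md) runs: the
`σ`-orbit of a tower element `t = ev₁(T)` is the exp-DEFORMATION `m ↦ ev_m(T)` (read `exp` as
`u ↦ e^{mu}`) sampled at `m = μᵏ`, `σᵏ(2πi) = 2πi/μᵏ`; a `ℚ`-relation `P(z, e^z) = 0` therefore holds
along `μ^ℕ`, which accumulates at `1`; the identity theorem makes it an identity in `m`; Ax's theorem
in the variable `m` plus "the only constants of the deformation are the periods" give `trdeg ≥ n`.
The skeleton cuts this at its two changes of category:

* `stub_orbitInterpolation` — **ORBIT INTERPOLATION** (twist-specific, analytic; size L). For the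
  twist data and a sector tuple `z` there are an open preconnected `U ∋ 1` and functions
  `Zᵢ` analytic on `U` with `Zᵢ(1) = zᵢ` such that, frequently as `m → 1` (`m ≠ 1`), `m = μᵏ ∈ U`
  and `Zᵢ(m) = σᵏ(zᵢ)` for all `i`. Why plausibly true: the set of `t ∈ ℂ` admitting a deformation
  analytic off a closed countable set avoiding `1` and all `μᵏ` and interpolating `k ↦ σᵏ(t)` is an
  intermediate field containing `ℚ̄` and closed under `exp` (sums/products/inverses: unions of
  singular sets plus the discrete zero set of a non-vanishing deformation; `exp t ↦ e^{m·f_t(m)}`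
  by the twist), hence contains `E`; shift by `r·2πi/m` for the period part (`σ(2πi) = 2πi/μ`,
  proved below); a co-countable open set is preconnected; `μᵏ` accumulates at `1` because `μ` is
  not a root of unity on the unit circle. Why it might fail: only through the bookkeeping of
  singular sets (essential singularities of nested deformations must stay countable and closed) —
  no transcendence input.
* `stub_noTwistedPeriods` — **NO TWISTED PERIODS IN THE TOWER** (twist-specific, arithmetic; size
  L). For the twist data, `E` contains no non-zero `x` with `σᵏ(x) = μ^{-k} x` for some `k ≥ 1`.
  Since `σᵏ(2πi) = μ^{-k}·2πi` (proved below) this says exactly that the weight-`μ^{-k}` eigenline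
  `ℂ·2πi ∩ …` misses `E`; in particular it contains `2πi ∉ E` (corollary
  `two_pi_I_not_mem_tower`, sorry-free from the stub's statement) — an OPEN statement on its own
  (it is implied by Schanuel), so the stub is genuinely load-bearing. Why plausibly true: the
  deformation `f` of such an `x` satisfies `f(μ^{kj}) = μ^{-kj} x`, so `f = x/m` near `1`, and then
  `m = x/f` is algebraic over a DEFORMATION TOWER `ℂ(e^{m g₁}, …, e^{m g_r})`
  (`g_j` algebraic over the earlier exponentials) — impossible by induction on `r` with Ax's
  theorem in the variable `m` ("Ax induction": a constant relation `∑ qⱼ m gⱼ = c` either shortens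
  the tower (`c = 0`) or exhibits `m` over a shorter tower (`c ≠ 0`)). Why it might fail: iff the
  twist data coexist with `2πi ∈ E`-type coincidences; a refutation refutes `TwistedSymmetry → π ∉ E`
  and hence the crux.
* `stub_axAccounting` — **AX ACCOUNTING** (σ-free functional transcendence; size L). For ANY open
  preconnected `U ∋ 1` and `Zᵢ` analytic on `U` with `Zᵢ(1) = zᵢ`, if (TRANSFER) every `ℚ`-polynomial
  relation of `(z, e^z)` holds identically for `(Z(m), e^{m Z(m)})` on `U`, and (NONDEG) every
  constant `c = m·∑ qᵢ Zᵢ(m)` (`q ∈ ℚⁿ`) is a rational multiple of `2πi`, and `z` is `ℚ`-linearly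
  independent, then `trdeg_ℚ ℚ(z, e^z) ≥ n`. Why plausibly true (paper proof): TRANSFER + evaluation
  at `1` identify the ideal of relations of the numbers with that of the functions, so
  `trdeg_ℚ ℚ(z,e^z) = trdeg_ℚ ℚ(Z, W)` (`W = e^{mZ}`, functions on `U`); with `yᵢ = m Zᵢ`,
  `W = e^{y}`, Ax's theorem (tree: `Literature.NumberTheory.Transcendental.ax_schanuel`, PROVED as
  `ax_schanuel_holds`) for `d/dm` gives `trdeg_ℂ ℂ(y, e^y) ≥ (n - d₀) + 1`, `d₀ = dim_ℚ` of the
  constants in `span_ℚ(y)`, `≤ 1` by NONDEG; hence `trdeg_{ℂ(m)} ℂ(m)(Z, W) ≥ n - d₀`, and when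
  `d₀ = 1` the function `c/m = ∑ qᵢ Zᵢ ∈ ℚ(Z)` restores the missing degree over `ℚ`. Why it might
  fail: bookkeeping only (function-field transcendence degrees over `ℚ ⊂ ℚ(c/m) ⊂ ℂ(m)`); the
  statement is a theorem-in-waiting, not a conjecture.

Composition (`TwistImpliesTowerPi_of`, SORRY-FREE, axioms `propext`, `Classical.choice`,
`Quot.sound`): destructure the twist; stub 1 gives `(U, Z)`; TRANSFER is PROVED here by the identity
theorem (`AnalyticOnNhd.eqOn_zero_of_preconnected_of_frequently_eq_zero`) — at an orbit point
`m = μᵏ` the deformed tuple is `σᵏ` applied to `(z, e^z)` because of the ITERATED TWIST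
`σᵏ(e^z) = e^{μᵏ σᵏ(z)}` (`pow_apply_exp`), and a ring endomorphism kills `ℚ`-relations
(`ringHom_aeval`), so the analytic function `m ↦ P(Z(m), e^{mZ(m)})` (`analyticOnNhd_aeval`) vanishes
frequently near `1 ∈ U`; NONDEG is PROVED here from THE TWIST REACHES THE PERIOD
(`sigma_two_pi_I : σ(2πi) = μ⁻¹·2πi`, from `σ` fixing every root of unity `e^{2πi/N}`:
`μσ(2πi) - 2πi ∈ 2πi·Nℤ` for all `N ≥ 1`) and stub 2: a constant `c = m ∑ qᵢ Zᵢ(m)` read at `m = 1`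
and at an orbit point `μᵏ ≠ 1` gives `σᵏ(x) = μ^{-k} x` for `x = ∑ qᵢ zᵢ = c`, the sector
decomposition `x_E = x + s·2πi ∈ E` (`s = ∑ qᵢ rᵢ ∈ ℚ`) inherits `σᵏ(x_E) = μ^{-k} x_E`, stub 2
forces `x_E = 0`, so `c = -s·2πi`. Then stub 3 concludes. The seam is NOT a one-line join: the two
conversions (numerical → functional; constants → periods) are where the route's thesis "a symmetry
turns a numerical relation into a functional one" is actually carried out.

Exactness / what each stub knows: stub 3 never sees `σ` (pure complex analysis + Ax); stub 1 never
sees a transcendence degree; stub 2 is the only place "π ∉ E"-strength arithmetic enters. None is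
the crux reworded: the BC3 probes `stubᵢ → TwistImpliesTowerPi` and `stubᵢ → Schanuel` by
`exact?` · `simpa` · `aesop` (and unfolded / hypothesis forms) fail 54/54 (+ 9/9 at 5× budget after
introducing the binders; seat folder `bc/probe_*.lean`, raw outputs in the seat's NOTES.md).

## Disproof used / negatives

No `Cruxes/TwistImpliesTowerPi/Disproof.lean`, no crux ideas, no lines at registration
(`ledger crux ls stmt-Schanuel-17225`: no workfiles, 2026-08-17); the opener's evidence
DEFORMATION.md (paper proofs) is attached to the item but not readable from the registrar's jail —
the seam follows the item docstring. `ledger negatives --problem Schanuel` (2026-08-17): 2 refuted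
statements (PolarPhantoms `trdeg < n`, stmt-Schanuel-6844/6846) — unrelated to all three stubs.

## References

* J. Ax, *On Schanuel's conjectures*, Ann. of Math. 93 (1971) 252–268, Thm 3. [Ax1971]
  (tree: `Literature.NumberTheory.Transcendental.ax_schanuel`, `ax_schanuel_holds`)
* L. Denis, *Indépendance algébrique de différents π*, Acta Arith. 69 (1995) 75–89,
  doi:10.4064/aa-69-1-75-89, Thm 3 / Cor 2 / Lemma 16 (the twisting automorphism). [Denis1995]
* J. Kirby, *Finitely presented exponential fields*, Algebra & Number Theory 7 (2013). [Kirby2013FPEF]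
* Mathlib: `AnalyticOnNhd.eqOn_zero_of_preconnected_of_frequently_eq_zero`,
  `Complex.exp_eq_exp_iff_exists_int`, `MvPolynomial.comp_aeval_apply`, `RingHom.toRatAlgHom`.
-/

set_option linter.dupNamespace false
set_option linter.unusedVariables false

noncomputable section

namespace Summit.Schanuel.Schanuel.Cruxes.TwistImpliesTowerPi.Birth

open Summit.Schanuel.Schanuel.Theses.TwistedConjugacy

/-! ## Signatures of the stubs, as propositions (for the composition and the probes) -/

/-- **Signature of stub 1 (orbit interpolation).** -/
def Sig.stub_orbitInterpolation : Prop :=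
  ∀ (μ : ℂ) (σ : ℂ →+* ℂ), IsAlgebraic ℚ μ → ‖μ‖ = 1 → (∀ n : ℕ, 0 < n → μ ^ n ≠ 1) →
    (∀ a : ℂ, IsAlgebraic ℚ a → σ a = a) →
    (∀ z : ℂ, σ (Complex.exp z) = Complex.exp (μ * σ z)) →
    ∀ (n : ℕ) (z : Fin n → ℂ),
      (∀ i, ∃ r : ℚ, z i + (r : ℂ) * (2 * (Real.pi : ℂ) * Complex.I) ∈
        (sInf {K : IntermediateField ℚ ℂ | algebraicClosure ℚ ℂ ≤ K ∧ ∀ w ∈ K, Complex.exp w ∈ K} :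
          IntermediateField ℚ ℂ)) →
      ∃ U : Set ℂ, IsOpen U ∧ IsPreconnected U ∧ (1 : ℂ) ∈ U ∧
        ∃ Z : Fin n → ℂ → ℂ, (∀ i, AnalyticOnNhd ℂ (Z i) U) ∧ (∀ i, Z i 1 = z i) ∧
          ∃ᶠ m in nhdsWithin (1 : ℂ) {1}ᶜ,
            m ∈ U ∧ ∃ k : ℕ, μ ^ k = m ∧ ∀ i, Z i m = (σ ^ k) (z i)

/-- **Signature of stub 2 (no twisted periods in the tower).** -/
def Sig.stub_noTwistedPeriods : Prop :=
  ∀ (μ : ℂ) (σ : ℂ →+* ℂ), IsAlgebraic ℚ μ → ‖μ‖ = 1 → (∀ n : ℕ, 0 < n → μ ^ n ≠ 1) →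
    (∀ a : ℂ, IsAlgebraic ℚ a → σ a = a) →
    (∀ z : ℂ, σ (Complex.exp z) = Complex.exp (μ * σ z)) →
    ∀ x ∈ (sInf {K : IntermediateField ℚ ℂ | algebraicClosure ℚ ℂ ≤ K ∧ ∀ w ∈ K, Complex.exp w ∈ K} :
        IntermediateField ℚ ℂ),
      ∀ k : ℕ, 0 < k → (σ ^ k) x = (μ ^ k)⁻¹ * x → x = 0

/-- **Signature of stub 3 (Ax accounting).** -/
def Sig.stub_axAccounting : Prop :=
  ∀ (n : ℕ) (z : Fin n → ℂ) (U : Set ℂ) (Z : Fin n → ℂ → ℂ),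
    IsOpen U → IsPreconnected U → (1 : ℂ) ∈ U → (∀ i, AnalyticOnNhd ℂ (Z i) U) →
    (∀ i, Z i 1 = z i) →
    (∀ P : MvPolynomial (Fin n ⊕ Fin n) ℚ,
        MvPolynomial.aeval (Sum.elim z (Complex.exp ∘ z)) P = 0 →
        ∀ m ∈ U, MvPolynomial.aeval
          (Sum.elim (fun i => Z i m) (fun i => Complex.exp (m * Z i m))) P = 0) →
    (∀ (q : Fin n → ℚ) (c : ℂ), (∀ m ∈ U, m * ∑ i, (q i : ℂ) * Z i m = c) →
        ∃ r : ℚ, c = (r : ℂ) * (2 * (Real.pi : ℂ) * Complex.I)) →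
    LinearIndependent ℚ z →
    (n : Cardinal) ≤ Algebra.trdeg ℚ
      ↥(IntermediateField.adjoin ℚ (Set.range z ∪ Set.range (Complex.exp ∘ z)))

/-! ## The three registered stubs (the only `sorry`s of this file) -/

/-- **Stub 1 — ORBIT INTERPOLATION (twist-specific, analytic).** For the twist data `(μ, σ)` and a
sector tuple `z` (`zᵢ + rᵢ·2πi ∈ E`): an open preconnected `U ∋ 1` and deformations `Zᵢ` analytic on
`U` with `Zᵢ(1) = zᵢ` which, frequently as `m → 1, m ≠ 1`, hit an orbit point: `m = μᵏ ∈ U` and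
`Zᵢ(m) = σᵏ(zᵢ)`. (Informal witness: `Zᵢ(m) = ev_m(Tᵢ) - rᵢ·2πi/m` on the complement of the countable
closed singular set of the term deformations, minus `0`.) [cite: Denis1995, Lemma 16; Ax1971, Thm 3] -/
theorem stub_orbitInterpolation :
    ∀ (μ : ℂ) (σ : ℂ →+* ℂ), IsAlgebraic ℚ μ → ‖μ‖ = 1 → (∀ n : ℕ, 0 < n → μ ^ n ≠ 1) →
      (∀ a : ℂ, IsAlgebraic ℚ a → σ a = a) →
      (∀ z : ℂ, σ (Complex.exp z) = Complex.exp (μ * σ z)) →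
      ∀ (n : ℕ) (z : Fin n → ℂ),
        (∀ i, ∃ r : ℚ, z i + (r : ℂ) * (2 * (Real.pi : ℂ) * Complex.I) ∈
          (sInf {K : IntermediateField ℚ ℂ |
              algebraicClosure ℚ ℂ ≤ K ∧ ∀ w ∈ K, Complex.exp w ∈ K} : IntermediateField ℚ ℂ)) →
        ∃ U : Set ℂ, IsOpen U ∧ IsPreconnected U ∧ (1 : ℂ) ∈ U ∧
          ∃ Z : Fin n → ℂ → ℂ, (∀ i, AnalyticOnNhd ℂ (Z i) U) ∧ (∀ i, Z i 1 = z i) ∧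
            ∃ᶠ m in nhdsWithin (1 : ℂ) {1}ᶜ,
              m ∈ U ∧ ∃ k : ℕ, μ ^ k = m ∧ ∀ i, Z i m = (σ ^ k) (z i) := by
  sorry

/-- **Stub 2 — NO TWISTED PERIODS IN THE TOWER (twist-specific, arithmetic: "Ax induction").** For the
twist data `(μ, σ)`, the exp-closure `E` of `ℚ̄` contains no non-zero `x` with `σᵏ(x) = μ^{-k}·x` for
some `k ≥ 1` — the weight-`μ^{-k}` eigenvectors (the line `ℂ·2πi` meets them: `σᵏ(2πi) = μ^{-k}·2πi`,
`pow_apply_two_pi_I`) stay out of the tower. Contains `2πi ∉ E` (`two_pi_I_not_mem_tower`).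
[cite: Ax1971, Thm 3] -/
theorem stub_noTwistedPeriods :
    ∀ (μ : ℂ) (σ : ℂ →+* ℂ), IsAlgebraic ℚ μ → ‖μ‖ = 1 → (∀ n : ℕ, 0 < n → μ ^ n ≠ 1) →
      (∀ a : ℂ, IsAlgebraic ℚ a → σ a = a) →
      (∀ z : ℂ, σ (Complex.exp z) = Complex.exp (μ * σ z)) →
      ∀ x ∈ (sInf {K : IntermediateField ℚ ℂ |
          algebraicClosure ℚ ℂ ≤ K ∧ ∀ w ∈ K, Complex.exp w ∈ K} : IntermediateField ℚ ℂ),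
        ∀ k : ℕ, 0 < k → (σ ^ k) x = (μ ^ k)⁻¹ * x → x = 0 := by
  sorry

/-- **Stub 3 — AX ACCOUNTING (σ-free functional transcendence).** Analytic deformations `Zᵢ` on an
open preconnected `U ∋ 1` with `Z(1) = z`, TRANSFER (every `ℚ`-relation of `(z, e^z)` holds for
`(Z(m), e^{mZ(m)})` along `U`) and NONDEG (the constants `m·∑ qᵢZᵢ(m)` are rational multiples of `2πi`)
force `trdeg_ℚ ℚ(z, e^z) ≥ n` for `ℚ`-linearly independent `z` — Ax's theorem in the variable `m`
(tree `ax_schanuel_holds`) plus the `d₀ ≤ 1` bookkeeping. [cite: Ax1971, Thm 3 and Cor 1] -/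
theorem stub_axAccounting :
    ∀ (n : ℕ) (z : Fin n → ℂ) (U : Set ℂ) (Z : Fin n → ℂ → ℂ),
      IsOpen U → IsPreconnected U → (1 : ℂ) ∈ U → (∀ i, AnalyticOnNhd ℂ (Z i) U) →
      (∀ i, Z i 1 = z i) →
      (∀ P : MvPolynomial (Fin n ⊕ Fin n) ℚ,
          MvPolynomial.aeval (Sum.elim z (Complex.exp ∘ z)) P = 0 →
          ∀ m ∈ U, MvPolynomial.aeval
            (Sum.elim (fun i => Z i m) (fun i => Complex.exp (m * Z i m))) P = 0) →
      (∀ (q : Fin n → ℚ) (c : ℂ), (∀ m ∈ U, m * ∑ i, (q i : ℂ) * Z i m = c) →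
          ∃ r : ℚ, c = (r : ℂ) * (2 * (Real.pi : ℂ) * Complex.I)) →
      LinearIndependent ℚ z →
      (n : Cardinal) ≤ Algebra.trdeg ℚ
        ↥(IntermediateField.adjoin ℚ (Set.range z ∪ Set.range (Complex.exp ∘ z))) := by
  sorry

/-! ## Sorry-free lemmas of the seam -/

section Seam

variable {μ : ℂ} {σ : ℂ →+* ℂ}

/-- Powers of `σ` fix what `σ` fixes. [folklore] -/
theorem pow_apply_of_fixed (k : ℕ) {a : ℂ} (ha : σ a = a) : (σ ^ k) a = a := by
  induction k with
  | zero => simp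
  | succ k ih => rw [pow_succ σ k, RingHom.coe_mul, Function.comp_apply, ha, ih]

/-- **The iterated twist**: `σᵏ(e^z) = e^{μᵏ·σᵏ(z)}`. [folklore] -/
theorem pow_apply_exp (hσμ : σ μ = μ)
    (hexp : ∀ z : ℂ, σ (Complex.exp z) = Complex.exp (μ * σ z)) (k : ℕ) (z : ℂ) :
    (σ ^ k) (Complex.exp z) = Complex.exp (μ ^ k * (σ ^ k) z) := by
  induction k generalizing z with
  | zero => simp
  | succ k ih =>
    rw [pow_succ σ k, RingHom.coe_mul]
    simp only [Function.comp_apply]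
    rw [hexp, ih, map_mul, pow_apply_of_fixed k hσμ]
    congr 1
    ring

/-- `e^{2πi/N}` is algebraic (a root of `X^N - 1`). [folklore] -/
theorem isAlgebraic_exp_two_pi_I_div (N : ℕ) (hN : 0 < N) :
    IsAlgebraic ℚ (Complex.exp (2 * (Real.pi : ℂ) * Complex.I / N)) := by
  have hN' : (N : ℂ) ≠ 0 := by exact_mod_cast hN.ne'
  refine IsAlgebraic.of_pow hN ?_
  have h : Complex.exp (2 * (Real.pi : ℂ) * Complex.I / N) ^ N = 1 := by
    rw [← Complex.exp_nat_mul]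
    have : (N : ℂ) * (2 * (Real.pi : ℂ) * Complex.I / N) = 2 * Real.pi * Complex.I := by
      field_simp
    rw [this, Complex.exp_two_pi_mul_I]
  rw [h]
  exact isAlgebraic_one

/-- **The twist reaches the period**: `σ(2πi) = 2πi/μ` — `σ` fixes every root of unity
`e^{2πi/N}`, so `e^{μσ(2πi)/N} = e^{2πi/N}` for all `N ≥ 1`, i.e. `μσ(2πi) - 2πi ∈ 2πi·Nℤ` for
all `N`, which forces `μσ(2πi) = 2πi`. [folklore] -/
theorem sigma_two_pi_I (hμ1 : ‖μ‖ = 1) (hfix : ∀ a : ℂ, IsAlgebraic ℚ a → σ a = a)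
    (hexp : ∀ z : ℂ, σ (Complex.exp z) = Complex.exp (μ * σ z)) :
    σ (2 * (Real.pi : ℂ) * Complex.I) = μ⁻¹ * (2 * (Real.pi : ℂ) * Complex.I) := by
  have hμ0 : μ ≠ 0 := by
    rintro rfl
    simp at hμ1
  set c : ℂ := 2 * (Real.pi : ℂ) * Complex.I with hc
  have hc0 : c ≠ 0 := by simp [hc, Real.pi_ne_zero, Complex.I_ne_zero]
  -- For every `N ≥ 1`: `μ σ c - c = N n c` for some integer `n`.
  have key : ∀ N : ℕ, 0 < N → ∃ n : ℤ, μ * σ c - c = (N : ℂ) * n * c := by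
    intro N hN
    have hN' : (N : ℂ) ≠ 0 := by exact_mod_cast hN.ne'
    set d : ℂ := c / N with hd
    have hcd : c = N * d := by rw [hd]; field_simp
    have halg : IsAlgebraic ℚ (Complex.exp d) := isAlgebraic_exp_two_pi_I_div N hN
    have h1 : σ (Complex.exp d) = Complex.exp d := hfix _ halg
    rw [hexp] at h1
    obtain ⟨n, hn⟩ := Complex.exp_eq_exp_iff_exists_int.1 h1
    rw [← hc] at hn
    refine ⟨n, ?_⟩
    have hσc : σ c = N * σ d := by rw [hcd, map_mul, map_natCast]
    rw [hσc]
    linear_combination (N : ℂ) * hn - hcd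
  obtain ⟨n₁, h₁⟩ := key 1 one_pos
  obtain ⟨N, hN⟩ : ∃ N : ℕ, N = n₁.natAbs + 1 := ⟨_, rfl⟩
  have hNpos : 0 < N := by omega
  obtain ⟨n₂, h₂⟩ := key N hNpos
  have h3 : (n₁ : ℂ) = (N : ℂ) * n₂ := by
    have h := h₁.symm.trans h₂
    have h' := mul_right_cancel₀ hc0 h
    simpa using h'
  have h4 : n₁ = (N : ℤ) * n₂ := by exact_mod_cast h3
  have h5 : n₁.natAbs = N * n₂.natAbs := by
    have h := congrArg Int.natAbs h4
    rwa [Int.natAbs_mul, Int.natAbs_natCast] at h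
  have h6 : n₂.natAbs = 0 := by
    rcases Nat.eq_zero_or_pos n₂.natAbs with h | h
    · exact h
    · exfalso
      have h7 : N ≤ N * n₂.natAbs := Nat.le_mul_of_pos_right N h
      generalize hP : N * n₂.natAbs = P at h5 h7
      omega
  have hn₂ : n₂ = 0 := Int.natAbs_eq_zero.1 h6
  have h7 : μ * σ c = c := by
    rw [hn₂] at h₂
    have : μ * σ c - c = 0 := by simpa using h₂
    exact sub_eq_zero.1 this
  calc σ c = μ⁻¹ * (μ * σ c) := by field_simp
    _ = μ⁻¹ * c := by rw [h7]

/-- Iterated: `σᵏ(2πi) = μ^{-k}·2πi` — the period spans the weight-`μ⁻¹` eigenline of the twist.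
[folklore] -/
theorem pow_apply_two_pi_I (hμalg : IsAlgebraic ℚ μ) (hμ1 : ‖μ‖ = 1)
    (hfix : ∀ a : ℂ, IsAlgebraic ℚ a → σ a = a)
    (hexp : ∀ z : ℂ, σ (Complex.exp z) = Complex.exp (μ * σ z)) (k : ℕ) :
    (σ ^ k) (2 * (Real.pi : ℂ) * Complex.I) = (μ ^ k)⁻¹ * (2 * (Real.pi : ℂ) * Complex.I) := by
  have hμ0 : μ ≠ 0 := by
    rintro rfl
    simp at hμ1
  induction k with
  | zero => simp
  | succ k ih =>
    rw [pow_succ σ k, RingHom.coe_mul, Function.comp_apply, sigma_two_pi_I hμ1 hfix hexp, map_mul,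
      pow_apply_of_fixed k (hfix _ hμalg.inv), ih, pow_succ, mul_inv]
    ring

/-- **Calibration of stub 2 (sorry-free from its statement): the period is not in the tower.**
Given the twist data, `Sig.stub_noTwistedPeriods` implies `2πi ∉ E` — because `σ(2πi) = μ⁻¹·2πi`
(`sigma_two_pi_I`) makes `2πi` itself a twisted period. So stub 2 carries (at least) the open
statement "`π` is not in the exp-closure of `ℚ̄`", which `TowerPiSchanuel` also implies: it is
load-bearing, not bookkeeping. [folklore] -/
theorem two_pi_I_not_mem_tower (h2 : Sig.stub_noTwistedPeriods) (hμalg : IsAlgebraic ℚ μ)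
    (hμ1 : ‖μ‖ = 1) (hμroot : ∀ n : ℕ, 0 < n → μ ^ n ≠ 1)
    (hfix : ∀ a : ℂ, IsAlgebraic ℚ a → σ a = a)
    (hexp : ∀ z : ℂ, σ (Complex.exp z) = Complex.exp (μ * σ z)) :
    (2 * (Real.pi : ℂ) * Complex.I) ∉
      (sInf {K : IntermediateField ℚ ℂ |
          algebraicClosure ℚ ℂ ≤ K ∧ ∀ w ∈ K, Complex.exp w ∈ K} : IntermediateField ℚ ℂ) := by
  intro hmem
  have hc0 : (2 * (Real.pi : ℂ) * Complex.I) ≠ 0 := by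
    simp [Real.pi_ne_zero, Complex.I_ne_zero]
  refine hc0 (h2 μ σ hμalg hμ1 hμroot hfix hexp _ hmem 1 one_pos ?_)
  simpa using pow_apply_two_pi_I hμalg hμ1 hfix hexp 1

/-- A ring endomorphism of `ℂ` commutes with evaluation of a `ℚ`-polynomial. [folklore] -/
theorem ringHom_aeval {ι : Type*} (φ : ℂ →+* ℂ) (v : ι → ℂ) (P : MvPolynomial ι ℚ) :
    φ (MvPolynomial.aeval v P) = MvPolynomial.aeval (fun j => φ (v j)) P := by
  have h := MvPolynomial.comp_aeval_apply (f := v) φ.toRatAlgHom P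
  simpa using h

/-- Polynomial expressions in analytic functions are analytic. [folklore] -/
theorem analyticOnNhd_aeval {ι : Type*} {U : Set ℂ} (w : ι → ℂ → ℂ)
    (hw : ∀ j, AnalyticOnNhd ℂ (w j) U) (P : MvPolynomial ι ℚ) :
    AnalyticOnNhd ℂ (fun m => MvPolynomial.aeval (fun j => w j m) P) U := by
  induction P using MvPolynomial.induction_on with
  | C a =>
    simpa using (analyticOnNhd_const : AnalyticOnNhd ℂ (fun _ : ℂ => (algebraMap ℚ ℂ a)) U)
  | add p q hp hq =>
    simp only [map_add]
    exact hp.add hq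
  | mul_X p j hp =>
    simpa [map_mul, MvPolynomial.aeval_X] using hp.mul (hw j)

end Seam

/-! ## The composition: the three stubs prove the crux -/

/-- **Composition** (`stub₁ → stub₂ → stub₃ → crux`, sorry-free). Given the twist `(μ, σ)` and a
sector tuple `z`: stub 1 supplies the analytic deformation `Z` interpolating the `σ`-orbit at the
points `μᵏ → 1`; the IDENTITY THEOREM (here) turns every numerical `ℚ`-relation among `(z, e^z)`
into a functional one along `U` (TRANSFER), the iterated twist `σᵏ e^{z} = e^{μᵏ σᵏ z}` matching
the second block of variables; the period computation `σᵏ(2πi) = μ^{-k} 2πi` (here) plus stub 2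
show that the only constants of the deformation are rational multiples of `2πi` (NONDEG); stub 3
concludes. [folklore] -/
theorem TwistImpliesTowerPi_of :
    Sig.stub_orbitInterpolation → Sig.stub_noTwistedPeriods → Sig.stub_axAccounting →
      TwistImpliesTowerPi := by
  intro h1 h2 h3
  rintro ⟨μ, hμalg, hμ1, hμroot, σ, hfix, hexp⟩ n z hz hli
  obtain ⟨U, hUo, hUc, h1U, Z, hZan, hZ1, hfreq⟩ := h1 μ σ hμalg hμ1 hμroot hfix hexp n z hz
  have hμ0 : μ ≠ 0 := by
    rintro rfl
    simp at hμ1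
  have hσμ : σ μ = μ := hfix μ hμalg
  refine h3 n z U Z hUo hUc h1U hZan hZ1 ?_ ?_ hli
  · -- TRANSFER: numerical relations become functional along `U` (identity theorem).
    intro P hP m hm
    set w : (Fin n ⊕ Fin n) → ℂ → ℂ := fun j m =>
      Sum.elim (fun i => Z i m) (fun i => Complex.exp (m * Z i m)) j with hw
    have hwan : ∀ j, AnalyticOnNhd ℂ (w j) U := by
      rintro (i | i)
      · simpa [hw] using hZan i
      · simpa [hw] using (analyticOnNhd_id.mul (hZan i)).cexp
    have hF : AnalyticOnNhd ℂ (fun m => MvPolynomial.aeval (fun j => w j m) P) U :=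
      analyticOnNhd_aeval w hwan P
    have hfreq0 : ∃ᶠ m in nhdsWithin (1 : ℂ) {1}ᶜ,
        (fun m => MvPolynomial.aeval (fun j => w j m) P) m = 0 := by
      refine hfreq.mono ?_
      rintro m ⟨hmU, k, hk, hZk⟩
      have hv : (fun j => w j m) = fun j => (σ ^ k) (Sum.elim z (Complex.exp ∘ z) j) := by
        funext j
        rcases j with i | i
        · simp [hw, hZk i]
        · simp only [hw, Sum.elim_inr, Function.comp_apply]
          rw [hZk i, ← hk, pow_apply_exp hσμ hexp k (z i)]
      show MvPolynomial.aeval (fun j => w j m) P = 0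
      rw [hv, ← ringHom_aeval (σ ^ k), hP, map_zero]
    have h0 := hF.eqOn_zero_of_preconnected_of_frequently_eq_zero hUc h1U hfreq0 hm
    simpa [hw] using h0
  · -- NONDEG: the only constants of the deformation are rational multiples of `2πi`.
    intro q c hc
    -- the number `x = ∑ qᵢ zᵢ` and its value `c` at `m = 1`
    have hx1 : c = ∑ i, (q i : ℂ) * z i := by
      have h := hc 1 h1U
      simpa [hZ1] using h.symm
    -- an orbit point `m = μᵏ ≠ 1` in `U`
    obtain ⟨m, ⟨hmU, k, hk, hZk⟩, hm1⟩ :=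
      (hfreq.and_eventually (self_mem_nhdsWithin : {(1 : ℂ)}ᶜ ∈ nhdsWithin (1 : ℂ) {1}ᶜ)).exists
    have hk0 : 0 < k := by
      rcases Nat.eq_zero_or_pos k with rfl | h
      · exact absurd (by simpa using hk.symm) hm1
      · exact h
    have hmk0 : μ ^ k ≠ 0 := pow_ne_zero k hμ0
    -- `σᵏ x = μ^{-k} x`
    have hσx : (σ ^ k) (∑ i, (q i : ℂ) * z i) = (μ ^ k)⁻¹ * ∑ i, (q i : ℂ) * z i := by
      have h := hc m hmU
      simp only [hZk] at h
      rw [← hk] at h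
      rw [map_sum]
      simp only [map_mul, map_ratCast]
      rw [← hx1, eq_inv_mul_iff_mul_eq₀ hmk0]
      exact h
    -- sector decomposition `x_E = x + s·2πi ∈ E`
    choose r hr using hz
    set E : IntermediateField ℚ ℂ :=
      sInf {K : IntermediateField ℚ ℂ | algebraicClosure ℚ ℂ ≤ K ∧ ∀ w ∈ K, Complex.exp w ∈ K}
      with hE
    have hxE : (∑ i, (q i : ℂ) * (z i + (r i : ℂ) * (2 * (Real.pi : ℂ) * Complex.I))) ∈ E := by
      refine sum_mem fun i _ => mul_mem ?_ (hr i)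
      have : ((q i : ℚ) : ℂ) = algebraMap ℚ ℂ (q i) := by simp
      rw [this]
      exact E.algebraMap_mem (q i)
    have hsplit : (∑ i, (q i : ℂ) * (z i + (r i : ℂ) * (2 * (Real.pi : ℂ) * Complex.I))) =
        (∑ i, (q i : ℂ) * z i) + (∑ i, (q i : ℂ) * (r i : ℂ)) * (2 * (Real.pi : ℂ) * Complex.I) := by
      rw [Finset.sum_mul, ← Finset.sum_add_distrib]
      refine Finset.sum_congr rfl fun i _ => ?_
      ring
    -- `σᵏ x_E = μ^{-k} x_E`, hence `x_E = 0` by stub 2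
    have hσxE : (σ ^ k) (∑ i, (q i : ℂ) * (z i + (r i : ℂ) * (2 * (Real.pi : ℂ) * Complex.I))) =
        (μ ^ k)⁻¹ * ∑ i, (q i : ℂ) * (z i + (r i : ℂ) * (2 * (Real.pi : ℂ) * Complex.I)) := by
      rw [hsplit, map_add, map_mul, hσx, pow_apply_two_pi_I hμalg hμ1 hfix hexp k, map_sum]
      simp only [map_mul, map_ratCast]
      ring
    have hxE0 := h2 μ σ hμalg hμ1 hμroot hfix hexp _ hxE k hk0 hσxE
    -- so `c = x = -s·2πi`
    refine ⟨-∑ i, q i * r i, ?_⟩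
    rw [hsplit] at hxE0
    rw [hx1]
    push_cast
    linear_combination hxE0

/-- **THE SKELETON THEOREM.** The crux `…TwistedConjugacy.TwistImpliesTowerPi`, concluded BY NAME
from the three DECLARED stubs (the only `sorry`s of the file) through the sorry-free composition
`TwistImpliesTowerPi_of`. [folklore] -/
theorem TwistImpliesTowerPi_proof : TwistImpliesTowerPi :=
  TwistImpliesTowerPi_of stub_orbitInterpolation stub_noTwistedPeriods stub_axAccounting

end Summit.Schanuel.Schanuel.Cruxes.TwistImpliesTowerPi.Birth

end
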